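import Summits.CriticalPhenomena.PercolationContinuityZ3.Theorems.Transplant.PlanarSkeletonFrmQuasiDefs
import Summits.CriticalPhenomena.PercolationContinuityZ3.Theorems.Transplant.SkelFrmQuasiBChoiceDefsV
import Summits.CriticalPhenomena.PercolationContinuityZ3.Theorems.Transplant.SkelFrmBChoiceDefsV
import Summits.CriticalPhenomena.PercolationContinuityZ3.Theorems.Transplant.SkelNeg1ChoiceAll
import Summits.CriticalPhenomena.PercolationContinuityZ3.Theorems.Transplant.SkelPhiCellsSmallMVQ
import Summits.CriticalPhenomena.PercolationContinuityZ3.Theorems.Transplant.SkelFrmQuasiBParamsLFA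
import HarnessLib
import Summits.CriticalPhenomena.PercolationContinuityZ3.Theorems.Transplant.SkelFrmBChoiceGeomV
/-!
# GEN-Q PORT (WAVE-Q table v0.8 section 2, row G081, U-level L12; captain R-6/R-7 2026-08-27: carrier token swap `PlanarSkeletonFrmFrom ↦ PlanarSkeletonFrmQuasi`)
# of the tree module «Transplant/SkelFrmFromBChoiceGeomV» (sha256 5979b86bc63acfa3…) onto the quasi-step carrier `PlanarSkeletonFrmQuasi` (p507026): «SkelFrmQuasiBChoiceGeomV»

HAND HUNKS (captain R-16 (a), this seat): (ii)/(iv) in all three kept theorems `(hstep : Skelφ.Steps G φ') ↦ {M : ℕ} (hq : Skelφ.QStepsN G φ' M)`; `hcol_fineA_atV`: `hR ↦ M·NrepA (cenS x) + 1 ≤ R`, callee `Skelφ.hcol_fineSkelV ↦ …_q` (gen-1's «SkelPhiCellsSmallMVQ»); `hcol_fineA_of_schedV` / `geom_fineA_at_bV`: `hcolQ : ∀ a x, NrepA (cenS x) + 1 ≤ rQ a x ↦ M·NrepA (cenS x) + 1 ≤ rQ a x` (= p3-g30's `colQ_schedOfT` at `M := Φ.M`), `weakSteps_fineA_at … hstep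 ↦ … hq` (this seat's G025 «SkelFrmQuasiBParamsLFA»).

ORIGINAL TITLE: N2 (frames-only node `SamePDropOfSkeletonFrm₁`, OPEN), WAVE 1 under (R-44)/(R-45): THE GEOMETRIC OBLIGATION OF THE CHOICE FUNCTION OF RECORD, SECOND CELL PORT —

builds on p205010 (kernel theorem, internal audit signed; external expert review pending) — nothing in this file uses p205010; NOTHING is claimed about any open node
((N3-b), the end state).  Lane `prim-bschramm`, seat `prim-bschramm-stmt` (gen 33; GEN-Q column pen; tool = captain gen-1 g4's port_genq.py R-14 --cone + p3-g30's T1 patch).  Helper file (`--supports stmt-CriticalPhenomena-4575 --as helper`).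
PORT RULES (U-wave r1–r4 re-used, GEN-Q hunk classes of p3-g29 #6136): declaration order, names and proof texts are those of «SkelFrmFromBChoiceGeomV», byte-identical except
(i) the carrier token `PlanarSkeletonFrmFrom ↦ PlanarSkeletonFrmQuasi` in binders, `namespace`/`end` lines and qualified names (module names `SkelFrmFrom… ↦ SkelFrmQuasi…`
in imports of already-ported rows); (ii) `Φ.step ↦ Φ.qstep` with the called Steps lemma replaced by its `…Q`/`_q` twin and the cost `Φ.M` threaded (none in this file unless
listed below); (iii) `Φ.cyl_connected ↦ Φ.cyl_reach` readers (none unless listed); (iv) graph-ball radii / window floors ×`Φ.M` (none unless listed).  Carrier-free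
residents stay imported/exported from the original «SkelFrmBChoiceGeomV» exactly as in the FrmFrom port.  Docstrings and citations are the original's.

-/

noncomputable section

open scoped Classical

namespace Summit.CriticalPhenomena.PercolationContinuityZ3.Theorems.Transplant

open MeasureTheory Literature.Probability.Percolation Literature.Probability.LatticeModels SimpleGraph KNCells
open Literature.Barriers.CriticalPhenomena (HasExponentialGrowth graphBall)

namespace PlanarSkeletonFrmQuasi

open SkelConc (Consts)
open BoxProdZ2 (ConcRadiiG)
open Skelφ (oriφ trφ)
open Skelφ.StepI (DataN DataNS OutNS)

namespace NegB

open Neg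

section Geom

variable (κ : Consts) {V : Type} [DecidableEq V] [Countable V] {G : SimpleGraph V} [G.LocallyFinite] (Φ : PlanarSkeletonFrmQuasi G) (t : V)
  (p : unitInterval) (D : DataNS V) (g f : ℕ) (c hf : Fin 2 → ℕ)

/-! ## §1 The column point over the staggered centre (V cells) -/

/-- **THE COLUMN POINT over the STAGGERED centre (V cells)** for the fine map of the (ζ′) chain: for every cube `Q x` of the V cells `fcellsV … c hf` and every radius
`R ≥ M·NrepA (cenS x) + 1` (quasi-step cost `M`), a vertex of fine position exactly `cenS x` inside the window span `VWin (Q x) R`. [cite: KozmaNitzan2024, §4 p. 26 ((29): columns)] -/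
theorem hcol_fineA_atV (κ : Consts) {V : Type} [DecidableEq V] [Countable V] {G : SimpleGraph V} [G.LocallyFinite] (Φ : PlanarSkeletonFrmQuasi G) (t : V) (p : unitInterval) (D : DataNS V) (g : ℕ) (f : ℕ) (c : Fin 2 → ℕ) (hf : Fin 2 → ℕ) {φ' : V → Site 2} (hlip : Skelφ.Lip G φ') {M : ℕ} (hq : Skelφ.QStepsN G φ' M) (hN : EqNumL κ Φ t p D g f) (x : Site 2) {R : ℕ}
    (hR : M * NrepA κ Φ t p D g f ((fcellsV κ Φ t p D g f c hf).cenS x) + 1 ≤ R) :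
    ∃ y ∈ Skelφ.VWin G (fineA κ Φ t p D g f φ') t ((fcellsV κ Φ t p D g f c hf).Q x) R, fineA κ Φ t p D g f φ' y = (fcellsV κ Φ t p D g f c hf).cenS x := by
  obtain ⟨hn1, hℓ1⟩ := one_le_of_eqNumL κ Φ t p D g f hN
  obtain ⟨r0, r1⟩ := room_fcellsA_at κ Φ t p D g f hN
  have hD := Skelφ.NegPrm.DofA_pos (Aof_pos κ).2 hn1 hℓ1 (hL κ Φ t p D g f) (vL κ Φ t p D g f)
  exact Skelφ.hcol_fineSkelV_q (A := Aof κ) (n := (nL κ Φ t p D g f : ℤ)) (h := hL κ Φ t p D g f) (vα := vL κ Φ t p D g f) (vβ := vβL κ Φ t p D g f) hlip hq t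
    (cA_pos κ Φ t p D g f 0) (cA_pos κ Φ t p D g f 1) hD r0 r1 (fcellsV κ Φ t p D g f c hf) x hR

/-- **`hcol` in the shape `sepGeomSG₂bV` consumes**, from a schedule whose cube radii dominate the column radius at the staggered centres of the V cells. [folklore] -/
theorem hcol_fineA_of_schedV (κ : Consts) {V : Type} [DecidableEq V] [Countable V] {G : SimpleGraph V} [G.LocallyFinite] (Φ : PlanarSkeletonFrmQuasi G) (t : V) (p : unitInterval) (D : DataNS V) (g : ℕ) (f : ℕ) (c : Fin 2 → ℕ) (hf : Fin 2 → ℕ) {φ' : V → Site 2} (hlip : Skelφ.Lip G φ') {M : ℕ} (hq : Skelφ.QStepsN G φ' M) (hN : EqNumL κ Φ t p D g f) {Λ : ConcRadiiG}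
    (hcolQ : ∀ a x, M * NrepA κ Φ t p D g f ((fcellsV κ Φ t p D g f c hf).cenS x) + 1 ≤ Λ.rQ a x) :
    ∀ a x, ∃ y ∈ Skelφ.VWin G (fineA κ Φ t p D g f φ') t ((fcellsV κ Φ t p D g f c hf).Q x) (Λ.rQ a x),
      fineA κ Φ t p D g f φ' y = (fcellsV κ Φ t p D g f c hf).cenS x :=
  fun a x => hcol_fineA_atV κ Φ t p D g f c hf hlip hq hN x (hcolQ a x)

/-! ## §2 The nine conjuncts for the V cells with small boxes -/

/-- **THE NINE `GeomHoldsN` CONJUNCTS FOR THE V CELLS OF RECORD WITH SMALL BOXES, map slot `φ′`** (`cellGeomSG₂bV … b₀` for any `b₀ ≤ 3r`, any creep / forward-room values `c hf`).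
[cite: KozmaNitzan2024, §4 pp. 25–29] -/
theorem geom_fineA_at_bV (κ : Consts) {V : Type} [DecidableEq V] [Countable V] {G : SimpleGraph V} [G.LocallyFinite] (Φ : PlanarSkeletonFrmQuasi G) (t : V) (p : unitInterval) (D : DataNS V) (g : ℕ) (f : ℕ) (c : Fin 2 → ℕ) (hf : Fin 2 → ℕ) {φ' : V → Site 2} (hlip : Skelφ.Lip G φ') {M : ℕ} (hq : Skelφ.QStepsN G φ' M) (hN : EqNumL κ Φ t p D g f) {Λ : ConcRadiiG}
    (hΛ : Skelφ.WFS2 (fcellsV κ Φ t p D g f c hf).toPCells2 Λ) (hcolQ : ∀ a x, M * NrepA κ Φ t p D g f ((fcellsV κ Φ t p D g f c hf).cenS x) + 1 ≤ Λ.rQ a x)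
    {b₀ : Fin 2 → ℕ} (hb : ∀ i, b₀ i ≤ 3 * (fcellsV κ Φ t p D g f c hf).r i) :
    (Skelφ.cellGeomSG₂bV G (fineA κ Φ t p D g f φ') (fcellsV κ Φ t p D g f c hf) t Λ b₀).root = t ∧
      κ.K₀ ≤ (Skelφ.cellGeomSG₂bV G (fineA κ Φ t p D g f φ') (fcellsV κ Φ t p D g f c hf) t Λ b₀).K ∧
      Skelφ.Lip G (fineA κ Φ t p D g f φ') ∧
      RunGeom G (Skelφ.cellGeomSG₂bV G (fineA κ Φ t p D g f φ') (fcellsV κ Φ t p D g f c hf) t Λ b₀) ∧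
      AnchGeom (Skelφ.cellGeomSG₂bV G (fineA κ Φ t p D g f φ') (fcellsV κ Φ t p D g f c hf) t Λ b₀) ∧
      SepGeom₂ G (Skelφ.cellGeomSG₂bV G (fineA κ Φ t p D g f φ') (fcellsV κ Φ t p D g f c hf) t Λ b₀) ∧
      ExitGeom G (Skelφ.cellGeomSG₂bV G (fineA κ Φ t p D g f φ') (fcellsV κ Φ t p D g f c hf) t Λ b₀) ∧
      StepsGeom (Skelφ.cellGeomSG₂bV G (fineA κ Φ t p D g f φ') (fcellsV κ Φ t p D g f c hf) t Λ b₀)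
        (Skelφ.faceDataSGV G (fineA κ Φ t p D g f φ') (fcellsV κ Φ t p D g f c hf) t Λ) ∧
      LevelGeom G (Skelφ.cellGeomSG₂bV G (fineA κ Φ t p D g f φ') (fcellsV κ Φ t p D g f c hf) t Λ b₀)
        (Skelφ.faceDataSGV G (fineA κ Φ t p D g f φ') (fcellsV κ Φ t p D g f c hf) t Λ)
        (Skelφ.levelDataSV (fineA κ Φ t p D g f φ') (fcellsV κ Φ t p D g f c hf)) := by
  have hψ0 := fineA_base_at κ Φ t p D g f φ' hN
  have hlipψ := lip_fineA_at κ Φ t p D g f hlip hN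
  have hws := weakSteps_fineA_at κ Φ t p D g f hq hN
  have hcol := hcol_fineA_of_schedV κ Φ t p D g f c hf hlip hq hN hcolQ
  refine ⟨rfl, (fcellsA_K κ Φ t p D g f).2.1, hlipψ, Skelφ.runGeomSG₂bV _ _ _, Skelφ.anchGeomSG₂bV _ _ _,
    Skelφ.sepGeom₂SG₂bV _ _ _ hΛ hψ0 hlipψ hws hcol, Skelφ.exitGeomSG₂bV _ _ _ hΛ hlipψ hb, Skelφ.stepsGeomSG₂bV _ _ _ hΛ hlipψ hws hb,
    Skelφ.levelGeomSG₂bV _ _ _ hΛ hlipψ hb⟩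

end Geom

end NegB

/-! ## §3 The geometric obligation of the choice function of record under (R-44)/(R-45) -/

-- GEN-Q (R-2, captain 2026-08-27): `PlanarSkeletonFrmFrom.geomHoldsNQFn_frmChoiceAllQ3V` is not in the used cone of the node top — not ported.

end PlanarSkeletonFrmQuasi

end Summit.CriticalPhenomena.PercolationContinuityZ3.Theorems.Transplant

end
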